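/-
Copyright (c) 2026 the pub-hodgecm-mathlib formalisation cell (harness21).  Prover seat hodgecm-mathlib-K2Liu-p01 (g8), Track B «K2-LIT»,
#184♮ = hLiu418 = `stmt-HodgeConjecture-24832`; #42S organ S1 ROAD W, F7 ∕ F7r ∕ F8 (RULINGS «M-158a» (2), «M-158b»); organ lead K2Liu-p06 (g4) SPEC-S1-AssemblySocket §2
row `hsum`; my SPEC-F7-FrameStep (ab42186030930277) §1–§2 lemma (i-b): ★ F4a's pairing `im(2·tr(𝕋₀ t G))` IS THE TRACE FORM `d⁻¹·Tr_{E∕F}(tr(H G))`, `H = δ̂·𝕋₀ t` hermitian.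
-/
import Literature.NumberTheory.GelbartRogawski1991.LocalDoubledSiegelUnipotentAnisotropy   -- ★ quadratic coordinates on `LocalRing E v`, `gramS`, `conjLocal`
import Literature.NumberTheory.GelbartRogawski1991.LocalDoubledUnitaryBigCellValue          -- ★ `gramS_map_conj`, `gramS_transpose`
import Mathlib.LinearAlgebra.Matrix.Trace
import HarnessLib

/-!
# Crux `HLiu418`, #42S-S1 ROAD W, file (T3-frame-i-b): THE SIEGEL PAIRING IS THE TRACE FORM —
# `ι(d · im(2·tr(𝕋₀ t G))) = tr(H G) + σ(tr(H G))`, `H = δ̂·(𝕋₀ t)`; and for `t` skew, `G` hermitian: `H` is hermitian and `tr(H G)` is `σ`-fixed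

Cell `hodgecm-mathlib`, crux item hLiu418 = `stmt-HodgeConjecture-24832` (helper lane `--supports … --as helper`, count-neutral).  THEOREMS ONLY (no `def`, no instance,
no notation, no named-fact hypothesis, no `sorry`).  PLACE-GENERIC over `LocalRing E v = Π_{w ∣ v} E_w` (every `v`; F7 ∕ F7r ∕ F8 alike).

WHY.  ★ (T3a) `K2LiuSiegelUnipotentPairingGram.dotProduct_cOfFix_tensorEmbLoc_nElem_eq_im_trace` writes ★ F4a's big-cell integrand as `ψ_v(−½ · im(2·tr(𝕋₀·t·G(x))))`; ★ (T3-frame-i-a)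
`K2LiuAddCharTrivialOnLattice` turns «`= 1` for all `t` in an `𝒪`-box» into «values in `𝔭^{m_ψ−k}`»; to read THAT as «`G(x) ∈ ϖ^m·Herm_n(𝒪_E)`» ((T3-frame-i-c), trace-form duality of
`Herm_n(𝒪_E)` at an unramified place) one needs the pairing as a TRACE FORM.  This file is that one-line dictionary (★ `IsQuadraticCoordinates.trace_delta_mul`: `δ̂ z + σ(δ̂ z) = ι(2 d · im z)`):
* §1 matrices over any commutative ring with an endomorphism `σ`: `conj_trace_mul_of_herm` (`H, G` hermitian ⇒ `σ(tr(HG)) = tr(HG)`), **`herm_smul_mul_of_skew`** (`t` skew for a `σ`-fixed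
  symmetric `S`, `σ ε = −ε` ⇒ `H := ε • (S t)` hermitian), `trace_smul_mul_mul`.
* §2 the dictionary on `LocalRing E v`: **`toLocalRing_d_mul_im_two_mul`** (`ι(d · im(2z)) = δ̂z + σ(δ̂z)`, ALL `z`), **`toLocalRing_d_mul_im_two_mul_trace`** (the matrix form, all `t, G`),
  `d_mul_im_two_mul_trace_eq_tau` (hypothesis-first trace functional `τ`, `ι(τ r) = r + σ r`, as ★ `K2LiuLocalRingValuationBalls` §2: `d · im(2·tr(𝕋₀ t G)) = τ(tr(H G))`),
  **`herm_delta_smul_gramS_mul`** (`H = δ̂ • (𝕋₀ t)` is hermitian for skew `t`, ★ `gramS_map_conj`, ★ `gramS_transpose`), `conjLocal_trace_herm_mul_herm`.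
[GelbartRogawski1991, §3.1 p. 454 (`⟨ , ⟩ = Tr_{E∕F} Φ`, `Φ = δ·h`)] [HarrisKudlaSweet1996, §1 (1.9)–(1.11)] [Shimura1997, §13.2].
HONEST LABEL.  Count-neutral helper; `HC_CM` is proved only modulo the 7 printed citations (2 remaining named inputs: hLiu418 = `stmt-HodgeConjecture-24832`,
h413 = `stmt-HodgeConjecture-24833`) until rung 0 closes.  NOT here: the duality (T3-frame-i-c) and the boxes `Λ₀ = ϖ^{c₀}(δ̂𝕋₀)⁻¹·L` (SPEC-F7-FrameStep §1).

## References
* [GelbartRogawski1991] S. Gelbart, J. Rogawski, *L-functions and Fourier–Jacobi coefficients for the unitary group U(3)*, Invent. Math. 105 (1991), §3.1.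
* [HarrisKudlaSweet1996] M. Harris, S. S. Kudla, W. J. Sweet, J. Amer. Math. Soc. 9 (1996), §1 (1.9)–(1.11).
* [Shimura1997] G. Shimura, *Euler products and Eisenstein series*, CBMS 93 (1997), §13.2.
-/

set_option autoImplicit false
set_option linter.dupNamespace false -- the mandated namespace repeats `HodgeConjecture.HodgeConjecture`

noncomputable section

open NumberField IsDedekindDomain Matrix
open Literature.NumberTheory.Automorphic Literature.NumberTheory.Automorphic.UnitaryGroup
open Literature.NumberTheory.Automorphic.UnitaryGroup.QuadraticCoordinates
open Literature.NumberTheory.GelbartRogawski1991.UnitaryDualPair Literature.NumberTheory.GelbartRogawski1991.UnitaryDualPair.LocalSplitting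

namespace Summit.HodgeConjecture.HodgeConjecture.Cruxes.HLiu418.K2LiuSiegelPairingTraceForm

/-! ## §1 Hermitian bookkeeping over any commutative ring -/

section Algebra

variable {R : Type*} [CommRing R] {ι : Type*} [Fintype ι] (σ : R →+* R)

/-- **`tr(H G)` is `σ`-fixed for `H, G` hermitian** (`(M.map σ)ᵀ = M`): `σ(tr(HG)) = tr(Hᵀ Gᵀ) = tr((GH)ᵀ) = tr(HG)`. [cite: Shimura1997, §13.2] -/
theorem conj_trace_mul_of_herm {H G : Matrix ι ι R} (hH : (H.map σ)ᵀ = H) (hG : (G.map σ)ᵀ = G) :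
    σ (Matrix.trace (H * G)) = Matrix.trace (H * G) := by
  have hH' : H.map σ = Hᵀ := by rw [← Matrix.transpose_transpose (H.map σ), hH]
  have hG' : G.map σ = Gᵀ := by rw [← Matrix.transpose_transpose (G.map σ), hG]
  rw [AddMonoidHom.map_trace σ (H * G), Matrix.map_mul, hH', hG', ← Matrix.transpose_mul, Matrix.trace_transpose, Matrix.trace_mul_comm]

/-- **`H := ε • (S t)` IS HERMITIAN when `t` is skew for `S`** (`(t.map σ)ᵀ S + S t = 0`), `S` `σ`-fixed and symmetric, `σ ε = −ε`:
`((ε S t).map σ)ᵀ = −ε (t.map σ)ᵀ S = ε S t`. [cite: HarrisKudlaSweet1996, §1 (1.11)] [cite: GelbartRogawski1991, §3.1 p. 454] -/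
theorem herm_smul_mul_of_skew {S t : Matrix ι ι R} {ε : R} (hS : S.map σ = S) (hST : Sᵀ = S) (hε : σ ε = -ε) (ht : (t.map σ)ᵀ * S + S * t = 0) :
    ((ε • (S * t)).map σ)ᵀ = ε • (S * t) := by
  have ht' : (t.map σ)ᵀ * S = -(S * t) := eq_neg_of_add_eq_zero_left ht
  have hsm : (ε • (S * t)).map σ = σ ε • ((S * t).map σ) := by
    ext i j
    simp only [Matrix.map_apply, Matrix.smul_apply, smul_eq_mul, map_mul]
  rw [hsm, Matrix.map_mul, hS, hε, Matrix.transpose_smul, Matrix.transpose_mul, hST, ht', smul_neg, neg_smul, neg_neg]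

/-- `tr((ε • (S t)) G) = ε · tr(S t G)`. [folklore] -/
theorem trace_smul_mul_mul (S t G : Matrix ι ι R) (ε : R) : Matrix.trace ((ε • (S * t)) * G) = ε * Matrix.trace (S * t * G) := by
  rw [Matrix.smul_mul, Matrix.trace_smul, smul_eq_mul]

end Algebra

/-! ## §2 The dictionary on `LocalRing E v` -/

section Local

variable (F : Type) [Field F] [NumberField F] (E : Type) [Field E] [NumberField E] [Algebra F E]
  [Algebra.IsQuadraticExtension F E] (c : E ≃ₐ[F] E)
  {δ : E} (hcδ : c δ = -δ) (hδ : δ ≠ 0) {d : F} (hd : δ * δ = algebraMap F E d)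
  (v : HeightOneSpectrum (𝓞 F)) (n : ℕ) {T₀ : Matrix (Fin n) (Fin n) F} (hT₀ : T₀.IsSymm)

include hd in
/-- **`ι(d · im(2z)) = δ̂ z + σ(δ̂ z)`** for EVERY `z ∈ LocalRing E v` (★ `IsQuadraticCoordinates.trace_delta_mul` + `im(2z) = 2·im z`). [cite: GelbartRogawski1991, §3.1 p. 454] -/
theorem toLocalRing_d_mul_im_two_mul (z : LocalRing E v) :
    toLocalRing E v ((d : v.adicCompletion F) * im (quadraticLocalEquiv E v c hcδ hδ).toLinearEquiv.toAddEquiv (2 * z)) =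
      algebraMap E (LocalRing E v) δ * z + conjLocal E c v (algebraMap E (LocalRing E v) δ * z) := by
  have hq := isQuadraticCoordinates_local E v c hcδ hδ hd
  rw [hq.trace_delta_mul (conjLocal_toLocalRing c v) (by rw [conjLocal_algebraMap, hcδ, map_neg]) z,
    show (2 : LocalRing E v) * z = toLocalRing E v 2 * z by rw [map_ofNat], hq.im_map_mul]
  ring_nf

include hd in
/-- **THE PAIRING AS A TRACE FORM, matrix version** (all `t, G`): `ι(d · im(2·tr(S t G))) = tr(H G) + σ(tr(H G))`, `H = δ̂ • (S t)`. [cite: GelbartRogawski1991, §3.1 p. 454] [cite: Shimura1997, §13.2] -/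
theorem toLocalRing_d_mul_im_two_mul_trace (S t G : Matrix (Fin n) (Fin n) (LocalRing E v)) :
    toLocalRing E v ((d : v.adicCompletion F) * im (quadraticLocalEquiv E v c hcδ hδ).toLinearEquiv.toAddEquiv (2 * Matrix.trace (S * t * G))) =
      Matrix.trace ((algebraMap E (LocalRing E v) δ • (S * t)) * G) + conjLocal E c v (Matrix.trace ((algebraMap E (LocalRing E v) δ • (S * t)) * G)) := by
  rw [toLocalRing_d_mul_im_two_mul F E c hcδ hδ hd v, trace_smul_mul_mul]

include hd in
/-- the same with a hypothesis-first TRACE FUNCTIONAL `τ` (`ι(τ r) = r + σ r`, as ★ `K2LiuLocalRingValuationBalls` §2): `d · im(2·tr(S t G)) = τ(tr(H G))`.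
[cite: GelbartRogawski1991, §3.1 p. 454] -/
theorem d_mul_im_two_mul_trace_eq_tau {τ : LocalRing E v → v.adicCompletion F} (hτ : ∀ r, toLocalRing E v (τ r) = r + conjLocal E c v r)
    (S t G : Matrix (Fin n) (Fin n) (LocalRing E v)) :
    (d : v.adicCompletion F) * im (quadraticLocalEquiv E v c hcδ hδ).toLinearEquiv.toAddEquiv (2 * Matrix.trace (S * t * G)) =
      τ (Matrix.trace ((algebraMap E (LocalRing E v) δ • (S * t)) * G)) :=
  toLocalRing_injective E v (by rw [toLocalRing_d_mul_im_two_mul_trace F E c hcδ hδ hd v, hτ])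

omit [Algebra.IsQuadraticExtension F E] in
include hcδ hT₀ in
/-- **`H = δ̂ • (𝕋₀ t)` IS HERMITIAN for skew `t`** (`𝕋₀ = gramS T₀` is `σ`-fixed and symmetric: ★ `gramS_map_conj`, ★ `gramS_transpose`). [cite: HarrisKudlaSweet1996, §1 (1.11)] -/
theorem herm_delta_smul_gramS_mul (t : Matrix (Fin n) (Fin n) (LocalRing E v))
    (ht : (t.map (conjLocal E c v))ᵀ * gramS F E v n T₀ + gramS F E v n T₀ * t = 0) :
    ((algebraMap E (LocalRing E v) δ • (gramS F E v n T₀ * t)).map (conjLocal E c v))ᵀ = algebraMap E (LocalRing E v) δ • (gramS F E v n T₀ * t) :=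
  herm_smul_mul_of_skew (conjLocal E c v) (gramS_map_conj F E c v n) (gramS_transpose F E v n hT₀) (by rw [conjLocal_algebraMap, hcδ, map_neg]) ht

omit [Algebra.IsQuadraticExtension F E] in
include hcδ hT₀ in
/-- hence `tr(H G)` is `σ`-FIXED for skew `t` and hermitian `G` — the value of the trace functional is `2·ι⁻¹(tr(HG))`-free bookkeeping for (T3-frame-i-c).
[cite: Shimura1997, §13.2] -/
theorem conjLocal_trace_herm_mul_herm (t : Matrix (Fin n) (Fin n) (LocalRing E v))
    (ht : (t.map (conjLocal E c v))ᵀ * gramS F E v n T₀ + gramS F E v n T₀ * t = 0) {G : Matrix (Fin n) (Fin n) (LocalRing E v)}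
    (hG : (G.map (conjLocal E c v))ᵀ = G) :
    conjLocal E c v (Matrix.trace ((algebraMap E (LocalRing E v) δ • (gramS F E v n T₀ * t)) * G)) =
      Matrix.trace ((algebraMap E (LocalRing E v) δ • (gramS F E v n T₀ * t)) * G) :=
  conj_trace_mul_of_herm (conjLocal E c v) (herm_delta_smul_gramS_mul F E c hcδ v n hT₀ t ht) hG

end Local

end Summit.HodgeConjecture.HodgeConjecture.Cruxes.HLiu418.K2LiuSiegelPairingTraceForm

end
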